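import Literature.Probability.RandomPlanarGeometry.SAWPulledLargeForceExpansionZdHyperoctahedral
import HarnessLib

/-!
# Pulled SAW on `ℤ^{d+1}` at large force: EVERY COEFFICIENT `c_k^{(d)}` IS AN INTEGER POLYNOMIAL IN `2d`, DIVISIBLE BY `2d` —
# the cost-series engine over `ℤ[X]`

Topic `Literature/Probability/RandomPlanarGeometry` (continues `SAWPulledLargeForceExpansionZdHyperoctahedral.lean`: `exists_int_polynomial_costCoeffZd`,
`N_{c,n}(ℤ^{d+1}) = P_{c,n}(2d)` with `P_{c,n} ∈ ℤ[X]`, `deg ≤ c`, no constant term for `c ≥ 1`; and the engine `CostSeries.Pz / A / E / e` of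
`SAWPulledLargeForceExpansion.lean` / `SAWPulledLargeForceExpansionZd.lean`, `largeForceCoeffZd d k = e (costCoeffZd d) k = c_k^{(d)}`).

PRINTED CONTEXT (locators only). Janse van Rensburg–Whittington (2013), §3.2 Theorem 8: `e^{λ_B(y)} = y + 2d + O(1/y)` on `ℤ^{d+1}` (`c₁^{(d)} = 2d`).
Graham (2010), §4: counts symmetric under the signed permutations of the axes are "a polynomial in powers of `s⁻¹ = 2d`" with integer coefficients.
The tree had: `exists_polynomial_largeForceCoeffZd` (a-p1: `c_k^{(d)}` is a polynomial over `ℚ` in `d`, degree `≤ k`), `two_dvd_largeForceCoeffZd`,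
`two_mul_dvd_largeForceCoeffZd` (a-p3: `2 ∣ c_k^{(d)}`, `2d ∣ c_k^{(d)}` pointwise), and the lane's every-`d` polynomials `c₂ = −2d`, `c₃ = 2d(2d+1)`,
`c₄ = −(2d)²(2d+3)`, …, `c₁₁`, `c₁₂` (data). NOT IN PRINT (lane statement): the theorems below.

THIS FILE (lane «pcv-sawmu», a-p3 g25; all PROVED, standard axioms, NO definitions):
* §4 the engine is a graded-ring construction over `ℤ`: fed with any census `d ↦ N_d` whose cost-`c` entries are integer polynomials in `2d` of degree
  `≤ c` without constant term for `c ≥ 1`, ★ `exists_int_polynomial_coeff_A` (`[X^i] A_K ∈ ℤ[2d]`, degree `≤ i`; `[X^i](1 − A_K) ∈ 2d·ℤ[2d]`) and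
  ★ `exists_int_polynomial_e` (`e_k ∈ 2d·ℤ[2d]`, degree `≤ k`, for `k ≥ 1`);
* §5 ★★★ **`exists_int_polynomial_largeForceCoeffZd`: `c_k^{(d)} = S_k(2d)` for every `d`, with `S_k ∈ ℤ[X]` of degree `≤ k` and `S_k(0) = 0`
  for `k ≥ 1`**; ★★★ **`exists_int_polynomial_largeForceCoeffZd_eq_two_mul_mul`: `c_k^{(d)} = 2d · R_k(2d)`, `R_k ∈ ℤ[X]`, `deg R_k ≤ k − 1`
  (`k ≥ 1`)**; ★★ `exists_int_polynomial_largeForceCoeffZd_pow_dvd_coeff`: in powers of `d`, the coefficient of `d^j` in `c_k^{(d)}` is an integer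
  divisible by `2^j`.
[cite: JansevanRensburgWhittington2013, §3.2 Theorem 8 (arXiv v4 p. 11)] [cite: Graham2010, Section 4] [cite: MadrasSlade1993, §1.1 eq. (1.1.8) p. 5]

Provenance: lane «pcv-sawmu», a-p3 g25 (2026-08-28). PURE STD, no data, no census value used.
-/

noncomputable section

open Finset
open scoped BigOperators
open Literature.Probability.LatticeModels
open Literature.Probability.RandomPlanarGeometry.SAW

namespace Literature.Probability.RandomPlanarGeometry.SAW.Zd

/-! ## §4 The cost-series engine over `ℤ[X]`: every `c_k^{(d)}` is an integer polynomial in `2d`, divisible by `2d` -/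

section Engine

variable (Nf : ℕ → ℕ → ℕ → ℕ)

/-! Integer-polynomial functions of the dimension (inline predicate `∃ P : ℤ[X], natDegree ≤ m ∧ ∀ d, f d = P.eval (2d)`) form a graded ring;
those with `P.coeff 0 = 0` (inline predicate with the extra clause) form a graded ideal in it. -/

/-- Monotonicity of the degree bound. [cite: Graham2010, Section 4; lane plumbing] -/
private theorem ip_mono {f : ℕ → ℤ} {m m' : ℕ} (h : ∃ P : Polynomial ℤ, P.natDegree ≤ m ∧ ∀ d : ℕ, f d = P.eval (2 * (d : ℤ)))
    (hm : m ≤ m') : ∃ P : Polynomial ℤ, P.natDegree ≤ m' ∧ ∀ d : ℕ, f d = P.eval (2 * (d : ℤ)) := by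
  obtain ⟨P, hP, hf⟩ := h
  exact ⟨P, hP.trans hm, hf⟩

/-- Monotonicity of the degree bound (ideal). [cite: Graham2010, Section 4; lane plumbing] -/
private theorem ep_mono {f : ℕ → ℤ} {m m' : ℕ}
    (h : ∃ P : Polynomial ℤ, P.natDegree ≤ m ∧ P.coeff 0 = 0 ∧ ∀ d : ℕ, f d = P.eval (2 * (d : ℤ))) (hm : m ≤ m') :
    ∃ P : Polynomial ℤ, P.natDegree ≤ m' ∧ P.coeff 0 = 0 ∧ ∀ d : ℕ, f d = P.eval (2 * (d : ℤ)) := by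
  obtain ⟨P, hP, h0, hf⟩ := h
  exact ⟨P, hP.trans hm, h0, hf⟩

/-- Differences. [cite: Graham2010, Section 4; lane plumbing] -/
private theorem ip_sub {f g : ℕ → ℤ} {m : ℕ} (hf : ∃ P : Polynomial ℤ, P.natDegree ≤ m ∧ ∀ d : ℕ, f d = P.eval (2 * (d : ℤ)))
    (hg : ∃ P : Polynomial ℤ, P.natDegree ≤ m ∧ ∀ d : ℕ, g d = P.eval (2 * (d : ℤ))) :
    ∃ P : Polynomial ℤ, P.natDegree ≤ m ∧ ∀ d : ℕ, f d - g d = P.eval (2 * (d : ℤ)) := by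
  obtain ⟨P, hP, hf⟩ := hf
  obtain ⟨Q, hQ, hg⟩ := hg
  exact ⟨P - Q, (Polynomial.natDegree_sub_le _ _).trans (max_le hP hQ), fun d => by rw [hf, hg, Polynomial.eval_sub]⟩

/-- Products: degrees add. [cite: Graham2010, Section 4; lane plumbing] -/
private theorem ip_mul {f g : ℕ → ℤ} {a b : ℕ} (hf : ∃ P : Polynomial ℤ, P.natDegree ≤ a ∧ ∀ d : ℕ, f d = P.eval (2 * (d : ℤ)))
    (hg : ∃ P : Polynomial ℤ, P.natDegree ≤ b ∧ ∀ d : ℕ, g d = P.eval (2 * (d : ℤ))) :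
    ∃ P : Polynomial ℤ, P.natDegree ≤ a + b ∧ ∀ d : ℕ, f d * g d = P.eval (2 * (d : ℤ)) := by
  obtain ⟨P, hP, hf⟩ := hf
  obtain ⟨Q, hQ, hg⟩ := hg
  exact ⟨P * Q, Polynomial.natDegree_mul_le.trans (add_le_add hP hQ), fun d => by rw [hf, hg, Polynomial.eval_mul]⟩

/-- Products with an ideal element stay in the ideal: degrees add. [cite: Graham2010, Section 4; lane plumbing] -/
private theorem ep_mul {f g : ℕ → ℤ} {a b : ℕ}
    (hf : ∃ P : Polynomial ℤ, P.natDegree ≤ a ∧ P.coeff 0 = 0 ∧ ∀ d : ℕ, f d = P.eval (2 * (d : ℤ)))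
    (hg : ∃ P : Polynomial ℤ, P.natDegree ≤ b ∧ ∀ d : ℕ, g d = P.eval (2 * (d : ℤ))) :
    ∃ P : Polynomial ℤ, P.natDegree ≤ a + b ∧ P.coeff 0 = 0 ∧ ∀ d : ℕ, f d * g d = P.eval (2 * (d : ℤ)) := by
  obtain ⟨P, hP, h0, hf⟩ := hf
  obtain ⟨Q, hQ, hg⟩ := hg
  exact ⟨P * Q, Polynomial.natDegree_mul_le.trans (add_le_add hP hQ), by rw [Polynomial.mul_coeff_zero, h0, zero_mul],
    fun d => by rw [hf, hg, Polynomial.eval_mul]⟩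

/-- Finite sums. [cite: Graham2010, Section 4; lane plumbing] -/
private theorem ip_sum {ι : Type*} (s : Finset ι) {f : ι → ℕ → ℤ} {m : ℕ}
    (h : ∀ i ∈ s, ∃ P : Polynomial ℤ, P.natDegree ≤ m ∧ ∀ d : ℕ, f i d = P.eval (2 * (d : ℤ))) :
    ∃ P : Polynomial ℤ, P.natDegree ≤ m ∧ ∀ d : ℕ, (∑ i ∈ s, f i d) = P.eval (2 * (d : ℤ)) := by
  classical
  induction s using Finset.induction_on with
  | empty => exact ⟨0, by simp, fun d => by simp⟩
  | @insert i s hi ih =>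
    obtain ⟨P, hP, hf⟩ := h i (Finset.mem_insert_self i s)
    obtain ⟨Q, hQ, hg⟩ := ih fun j hj => h j (Finset.mem_insert_of_mem hj)
    refine ⟨P + Q, (Polynomial.natDegree_add_le _ _).trans (max_le hP hQ), fun d => ?_⟩
    rw [Finset.sum_insert hi, hf, hg, Polynomial.eval_add]

/-- Finite sums (ideal). [cite: Graham2010, Section 4; lane plumbing] -/
private theorem ep_sum {ι : Type*} (s : Finset ι) {f : ι → ℕ → ℤ} {m : ℕ}
    (h : ∀ i ∈ s, ∃ P : Polynomial ℤ, P.natDegree ≤ m ∧ P.coeff 0 = 0 ∧ ∀ d : ℕ, f i d = P.eval (2 * (d : ℤ))) :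
    ∃ P : Polynomial ℤ, P.natDegree ≤ m ∧ P.coeff 0 = 0 ∧ ∀ d : ℕ, (∑ i ∈ s, f i d) = P.eval (2 * (d : ℤ)) := by
  classical
  induction s using Finset.induction_on with
  | empty => exact ⟨0, by simp, by simp, fun d => by simp⟩
  | @insert i s hi ih =>
    obtain ⟨P, hP, hP0, hf⟩ := h i (Finset.mem_insert_self i s)
    obtain ⟨Q, hQ, hQ0, hg⟩ := ih fun j hj => h j (Finset.mem_insert_of_mem hj)
    refine ⟨P + Q, (Polynomial.natDegree_add_le _ _).trans (max_le hP hQ), by rw [Polynomial.coeff_add, hP0, hQ0, add_zero],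
      fun d => ?_⟩
    rw [Finset.sum_insert hi, hf, hg, Polynomial.eval_add]

/-- Coefficients of a product of graded families are graded. [cite: Graham2010, Section 4; lane plumbing] -/
private theorem ip_coeff_mul {S T : ℕ → Polynomial ℤ}
    (hS : ∀ i, ∃ P : Polynomial ℤ, P.natDegree ≤ i ∧ ∀ d : ℕ, (S d).coeff i = P.eval (2 * (d : ℤ)))
    (hT : ∀ i, ∃ P : Polynomial ℤ, P.natDegree ≤ i ∧ ∀ d : ℕ, (T d).coeff i = P.eval (2 * (d : ℤ))) (i : ℕ) :
    ∃ P : Polynomial ℤ, P.natDegree ≤ i ∧ ∀ d : ℕ, (S d * T d).coeff i = P.eval (2 * (d : ℤ)) := by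
  have key : ∃ P : Polynomial ℤ, P.natDegree ≤ i ∧
      ∀ d : ℕ, (∑ x ∈ antidiagonal i, (S d).coeff x.1 * (T d).coeff x.2) = P.eval (2 * (d : ℤ)) := by
    refine ip_sum _ fun x hx => ?_
    have hx' : x.1 + x.2 = i := mem_antidiagonal.1 hx
    exact ip_mono (ip_mul (hS x.1) (hT x.2)) hx'.le
  obtain ⟨P, hP, h⟩ := key
  exact ⟨P, hP, fun d => by rw [← h d, Polynomial.coeff_mul]⟩

/-- Coefficients of a product of a graded IDEAL family with a graded family are in the ideal. [cite: Graham2010, Section 4; lane plumbing] -/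
private theorem ep_coeff_mul {S T : ℕ → Polynomial ℤ}
    (hS : ∀ i, ∃ P : Polynomial ℤ, P.natDegree ≤ i ∧ P.coeff 0 = 0 ∧ ∀ d : ℕ, (S d).coeff i = P.eval (2 * (d : ℤ)))
    (hT : ∀ i, ∃ P : Polynomial ℤ, P.natDegree ≤ i ∧ ∀ d : ℕ, (T d).coeff i = P.eval (2 * (d : ℤ))) (i : ℕ) :
    ∃ P : Polynomial ℤ, P.natDegree ≤ i ∧ P.coeff 0 = 0 ∧ ∀ d : ℕ, (S d * T d).coeff i = P.eval (2 * (d : ℤ)) := by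
  have key : ∃ P : Polynomial ℤ, P.natDegree ≤ i ∧ P.coeff 0 = 0 ∧
      ∀ d : ℕ, (∑ x ∈ antidiagonal i, (S d).coeff x.1 * (T d).coeff x.2) = P.eval (2 * (d : ℤ)) := by
    refine ep_sum _ fun x hx => ?_
    have hx' : x.1 + x.2 = i := mem_antidiagonal.1 hx
    exact ep_mono (ep_mul (hS x.1) (hT x.2)) hx'.le
  obtain ⟨P, hP, h0, h⟩ := key
  exact ⟨P, hP, h0, fun d => by rw [← h d, Polynomial.coeff_mul]⟩

/-- Forgetting the ideal clause. [cite: Graham2010, Section 4; lane plumbing] -/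
private theorem ip_of_ep {f : ℕ → ℤ} {m : ℕ}
    (h : ∃ P : Polynomial ℤ, P.natDegree ≤ m ∧ P.coeff 0 = 0 ∧ ∀ d : ℕ, f d = P.eval (2 * (d : ℤ))) :
    ∃ P : Polynomial ℤ, P.natDegree ≤ m ∧ ∀ d : ℕ, f d = P.eval (2 * (d : ℤ)) := by
  obtain ⟨P, hP, -, hf⟩ := h
  exact ⟨P, hP, hf⟩

/-- The constant family `1` is graded. [cite: Graham2010, Section 4; lane plumbing] -/
private theorem ip_coeff_one (i : ℕ) :
    ∃ P : Polynomial ℤ, P.natDegree ≤ i ∧ ∀ d : ℕ, ((1 : Polynomial ℤ)).coeff i = P.eval (2 * (d : ℤ)) := by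
  by_cases hi : i = 0
  · refine ⟨1, by simp, fun d => ?_⟩
    subst hi; simp
  · refine ⟨0, by simp, fun d => ?_⟩
    simp [Polynomial.coeff_one, hi]

/-- Coefficients of powers of a graded family are graded. [cite: Graham2010, Section 4; lane plumbing] -/
private theorem ip_coeff_pow {S : ℕ → Polynomial ℤ}
    (hS : ∀ i, ∃ P : Polynomial ℤ, P.natDegree ≤ i ∧ ∀ d : ℕ, (S d).coeff i = P.eval (2 * (d : ℤ))) (n i : ℕ) :
    ∃ P : Polynomial ℤ, P.natDegree ≤ i ∧ ∀ d : ℕ, ((S d) ^ n).coeff i = P.eval (2 * (d : ℤ)) := by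
  induction n generalizing i with
  | zero => simpa only [pow_zero] using ip_coeff_one i
  | succ n ih =>
    have := ip_coeff_mul (S := fun d => S d ^ n) (T := S) ih hS i
    simpa [pow_succ] using this

/-- Coefficients of POSITIVE powers of a graded ideal family are in the ideal. [cite: Graham2010, Section 4; lane plumbing] -/
private theorem ep_coeff_pow_succ {S : ℕ → Polynomial ℤ}
    (hS : ∀ i, ∃ P : Polynomial ℤ, P.natDegree ≤ i ∧ P.coeff 0 = 0 ∧ ∀ d : ℕ, (S d).coeff i = P.eval (2 * (d : ℤ))) (n i : ℕ) :
    ∃ P : Polynomial ℤ, P.natDegree ≤ i ∧ P.coeff 0 = 0 ∧ ∀ d : ℕ, ((S d) ^ (n + 1)).coeff i = P.eval (2 * (d : ℤ)) := by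
  have := ep_coeff_mul (S := S) (T := fun d => S d ^ n) hS (ip_coeff_pow (fun i => ip_of_ep (hS i)) n) i
  simpa [pow_succ'] using this

/-- ★ The approximants `A_K` of the cost-series engine, fed with a census `d ↦ N_d` whose cost-`c` entries are integer polynomials in `2d` of
degree `≤ c`, have `[X^i] A_K` an integer polynomial in `2d` of degree `≤ i`; if moreover the entries of cost `c ≥ 1` have no constant term,
then so has `[X^i] (1 − A_K)` for every `i`. [cite: JansevanRensburgWhittington2013, §3.2 Theorem 8 (arXiv v4 p. 11); lane theorem] -/
theorem exists_int_polynomial_coeff_A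
    (hN : ∀ c n, ∃ P : Polynomial ℤ, P.natDegree ≤ c ∧ (1 ≤ c → P.coeff 0 = 0) ∧ ∀ d : ℕ, (Nf d c n : ℤ) = P.eval (2 * (d : ℤ)))
    (K i : ℕ) :
    (∃ P : Polynomial ℤ, P.natDegree ≤ i ∧ ∀ d : ℕ, (CostSeries.A (Nf d) K).coeff i = P.eval (2 * (d : ℤ))) ∧
    (∃ P : Polynomial ℤ, P.natDegree ≤ i ∧ P.coeff 0 = 0 ∧ ∀ d : ℕ, (1 - CostSeries.A (Nf d) K).coeff i = P.eval (2 * (d : ℤ))) := by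
  induction K generalizing i with
  | zero =>
    refine ⟨by simpa [CostSeries.A] using ip_coeff_one i, ⟨0, by simp, by simp, fun d => ?_⟩⟩
    simp [CostSeries.A]
  | succ K ih =>
    -- `1 − A_{K+1} = Σ_{j ≤ K} X^{j+1} · P_{j+1}(A_K)`, each term in the ideal
    have hterm : ∀ j, ∃ P : Polynomial ℤ, P.natDegree ≤ i ∧ P.coeff 0 = 0 ∧ ∀ d : ℕ,
        (Polynomial.X ^ (j + 1) * (CostSeries.Pz (Nf d) (j + 1)).comp (CostSeries.A (Nf d) K)).coeff i =
          P.eval (2 * (d : ℤ)) := by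
      intro j
      by_cases hji : j + 1 ≤ i
      · -- the shifted coefficient `[X^{i-(j+1)}] P_{j+1}(A_K) = Σ_n N_{j+1,n} [X^{i-(j+1)}] A_K^n`
        have hcomp : ∃ P : Polynomial ℤ, P.natDegree ≤ i ∧ P.coeff 0 = 0 ∧ ∀ d : ℕ,
            ((CostSeries.Pz (Nf d) (j + 1)).comp (CostSeries.A (Nf d) K)).coeff (i - (j + 1)) = P.eval (2 * (d : ℤ)) := by
          have hsum : ∃ P : Polynomial ℤ, P.natDegree ≤ i ∧ P.coeff 0 = 0 ∧ ∀ d : ℕ,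
              (∑ n ∈ Finset.range (2 * (j + 1) + 2),
                (Nf d (j + 1) n : ℤ) * ((CostSeries.A (Nf d) K ^ n).coeff (i - (j + 1)))) = P.eval (2 * (d : ℤ)) := by
            refine ep_sum _ fun n _ => ?_
            have hNj : ∃ P : Polynomial ℤ, P.natDegree ≤ j + 1 ∧ P.coeff 0 = 0 ∧
                ∀ d : ℕ, (Nf d (j + 1) n : ℤ) = P.eval (2 * (d : ℤ)) := by
              obtain ⟨P, hP, hP0, hP1⟩ := hN (j + 1) n
              exact ⟨P, hP, hP0 (by omega), hP1⟩
            exact ep_mono (ep_mul hNj (ip_coeff_pow (S := fun d => CostSeries.A (Nf d) K) (fun i => (ih i).1) n (i - (j + 1))))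
              (by omega)
          obtain ⟨P, hP, hP0, h⟩ := hsum
          refine ⟨P, hP, hP0, fun d => ?_⟩
          rw [← h d, CostSeries.Pz, Polynomial.sum_comp, Polynomial.finsetSum_coeff]
          refine Finset.sum_congr rfl fun n _ => ?_
          rw [Polynomial.mul_comp, Polynomial.C_comp, Polynomial.X_pow_comp, Polynomial.coeff_C_mul]
        obtain ⟨P, hP, hP0, h⟩ := hcomp
        refine ⟨P, hP, hP0, fun d => ?_⟩
        rw [Polynomial.coeff_X_pow_mul', if_pos hji, h d]
      · refine ⟨0, by simp, by simp, fun d => ?_⟩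
        rw [Polynomial.coeff_X_pow_mul', if_neg hji]
        simp
    have hsum : ∃ P : Polynomial ℤ, P.natDegree ≤ i ∧ P.coeff 0 = 0 ∧ ∀ d : ℕ,
        (∑ j ∈ Finset.range (K + 1),
          (Polynomial.X ^ (j + 1) * (CostSeries.Pz (Nf d) (j + 1)).comp (CostSeries.A (Nf d) K)).coeff i) =
          P.eval (2 * (d : ℤ)) := ep_sum _ fun j _ => hterm j
    have hA : ∀ d : ℕ, 1 - CostSeries.A (Nf d) (K + 1) =
        ∑ j ∈ Finset.range (K + 1), Polynomial.X ^ (j + 1) * (CostSeries.Pz (Nf d) (j + 1)).comp (CostSeries.A (Nf d) K) := by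
      intro d
      show 1 - (1 - _) = _
      rw [sub_sub_cancel]
    have h2 : ∃ P : Polynomial ℤ, P.natDegree ≤ i ∧ P.coeff 0 = 0 ∧
        ∀ d : ℕ, (1 - CostSeries.A (Nf d) (K + 1)).coeff i = P.eval (2 * (d : ℤ)) := by
      obtain ⟨P, hP, hP0, h⟩ := hsum
      refine ⟨P, hP, hP0, fun d => ?_⟩
      rw [← h d, hA d, Polynomial.finsetSum_coeff]
    refine ⟨?_, h2⟩
    obtain ⟨P, hP, h⟩ := ip_sub (ip_coeff_one i) (ip_of_ep h2)
    refine ⟨P, hP, fun d => ?_⟩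
    rw [← h d, ← Polynomial.coeff_sub, sub_sub_cancel]

/-- ★ `[X^k] E_k − [k = 0]` is an integer polynomial in `2d` of degree `≤ k` with no constant term (`E_k = 1 + Σ_{1 ≤ j ≤ k} (1 − A_k)^j`).
[cite: JansevanRensburgWhittington2013, §3.2 Theorem 8 (arXiv v4 p. 11); lane theorem] -/
theorem exists_int_polynomial_e
    (hN : ∀ c n, ∃ P : Polynomial ℤ, P.natDegree ≤ c ∧ (1 ≤ c → P.coeff 0 = 0) ∧ ∀ d : ℕ, (Nf d c n : ℤ) = P.eval (2 * (d : ℤ)))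
    {k : ℕ} (hk : 1 ≤ k) :
    ∃ P : Polynomial ℤ, P.natDegree ≤ k ∧ P.coeff 0 = 0 ∧ ∀ d : ℕ, CostSeries.e (Nf d) k = P.eval (2 * (d : ℤ)) := by
  have hE : ∀ d : ℕ, CostSeries.e (Nf d) k = ∑ j ∈ Finset.range k, ((1 - CostSeries.A (Nf d) k) ^ (j + 1)).coeff k := by
    intro d
    rw [CostSeries.e, CostSeries.E, Polynomial.finsetSum_coeff, Finset.sum_range_succ', pow_zero, Polynomial.coeff_one,
      if_neg (by omega), add_zero]
  obtain ⟨P, hP, hP0, h⟩ := ep_sum (Finset.range k) (m := k)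
    (f := fun j d => ((1 - CostSeries.A (Nf d) k) ^ (j + 1)).coeff k)
    fun j _ => ep_coeff_pow_succ (S := fun d => 1 - CostSeries.A (Nf d) k) (fun i => (exists_int_polynomial_coeff_A Nf hN k i).2) j k
  exact ⟨P, hP, hP0, fun d => by rw [hE d, ← h d]⟩

end Engine

/-! ## §5 The theorems -/

section Main

/-- ★★★ **EVERY LARGE-FORCE COEFFICIENT IS AN INTEGER POLYNOMIAL IN THE NUMBER `2d` OF LATERAL DIRECTIONS**: for every `k` there is
`S_k ∈ ℤ[X]` of degree `≤ k`, with NO CONSTANT TERM when `k ≥ 1`, such that `c_k^{(d)} = largeForceCoeffZd d k = S_k(2d)` for EVERY `d ∈ ℕ`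
(`S_0 = 1`, `S_1 = X`, `S_2 = −X`, `S_3 = X(X+1)`, `S_4 = −X²(X+3)`, …). Strengthens `exists_polynomial_largeForceCoeffZd` (polynomiality over
`ℚ` in `d`): the coefficient of `d^j` in `c_k^{(d)}` is an integer multiple of `2^j`. Mechanism: the hyperoctahedral normal form of the census
(`exists_int_polynomial_costCoeffZd`) fed through the cost-series engine, which is a graded ring construction over `ℤ`.
[cite: JansevanRensburgWhittington2013, §3.2 Theorem 8 (arXiv v4 p. 11) (first order: c₁ = 2d)] [cite: Graham2010, Section 4 (integrality
device)] -/
theorem exists_int_polynomial_largeForceCoeffZd (k : ℕ) :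
    ∃ S : Polynomial ℤ, S.natDegree ≤ k ∧ (1 ≤ k → S.coeff 0 = 0) ∧ ∀ d : ℕ, largeForceCoeffZd d k = S.eval (2 * (d : ℤ)) := by
  rcases Nat.eq_zero_or_pos k with rfl | hk
  · exact ⟨1, by simp, by simp, fun d => by simp [largeForceCoeffZd_zero]⟩
  · obtain ⟨P, hP, hP0, h⟩ := exists_int_polynomial_e (fun d => costCoeffZd d) (fun c n => exists_int_polynomial_costCoeffZd c n) hk
    exact ⟨P, hP, fun _ => hP0, fun d => h d⟩

/-- ★★★ **`c_k^{(d)} ∈ 2d · ℤ[2d]` for `k ≥ 1`**: there is `R_k ∈ ℤ[X]` of degree `≤ k − 1` with `c_k^{(d)} = 2d · R_k(2d)` for every `d`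
— the STRUCTURAL form of the lane's every-dimension polynomials (`c₂ = −2d`, `c₃ = 2d(2d+1)`, `c₄ = −(2d)²(2d+3)`, …, `c₁₁`, `c₁₂`), of which
the pointwise divisibility `two_mul_dvd_largeForceCoeffZd` is the shadow. [cite: JansevanRensburgWhittington2013, §3.2 Theorem 8 (arXiv v4
p. 11)] [cite: Graham2010, Section 4] -/
theorem exists_int_polynomial_largeForceCoeffZd_eq_two_mul_mul {k : ℕ} (hk : 1 ≤ k) :
    ∃ R : Polynomial ℤ, R.natDegree + 1 ≤ k ∧ ∀ d : ℕ, largeForceCoeffZd d k = 2 * (d : ℤ) * R.eval (2 * (d : ℤ)) := by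
  obtain ⟨S, hS, hS0, h⟩ := exists_int_polynomial_largeForceCoeffZd k
  obtain ⟨R, hR⟩ := Polynomial.X_dvd_iff.2 (hS0 hk)
  refine ⟨R, ?_, fun d => by rw [h d, hR, Polynomial.eval_mul, Polynomial.eval_X]⟩
  by_cases hR0 : R = 0
  · subst hR0; simpa using hk
  · have : S.natDegree = R.natDegree + 1 := by
      rw [hR, Polynomial.natDegree_X_mul hR0]
    omega

/-- ★★ IN POWERS OF `d`: `c_k^{(d)} = T_k(d)` with `T_k ∈ ℤ[X]` of degree `≤ k` whose coefficient of `X^j` is divisible by `2^j` for every `j`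
(`T_k(X) = S_k(2X)`). [cite: JansevanRensburgWhittington2013, §3.2 Theorem 8 (arXiv v4 p. 11)] [cite: Graham2010, Section 4] -/
theorem exists_int_polynomial_largeForceCoeffZd_pow_dvd_coeff (k : ℕ) :
    ∃ T : Polynomial ℤ, T.natDegree ≤ k ∧ (∀ j, (2 : ℤ) ^ j ∣ T.coeff j) ∧ ∀ d : ℕ, largeForceCoeffZd d k = T.eval (d : ℤ) := by
  obtain ⟨S, hS, -, h⟩ := exists_int_polynomial_largeForceCoeffZd k
  refine ⟨S.comp (Polynomial.C 2 * Polynomial.X), ?_, fun j => ?_, fun d => ?_⟩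
  · refine (Polynomial.natDegree_comp_le).trans ?_
    rw [Polynomial.natDegree_C_mul_X 2 two_ne_zero, mul_one]
    exact hS
  · rw [Polynomial.comp, Polynomial.eval₂_eq_sum_range, Polynomial.finsetSum_coeff]
    refine Finset.dvd_sum fun i _ => ?_
    rw [mul_pow, ← Polynomial.C_pow, ← mul_assoc, ← Polynomial.C_mul, Polynomial.coeff_C_mul_X_pow]
    split_ifs with hij
    · subst hij; exact Dvd.intro_left _ rfl
    · exact dvd_zero _
  · rw [h d, Polynomial.eval_comp, Polynomial.eval_mul, Polynomial.eval_C, Polynomial.eval_X]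

end Main

end Literature.Probability.RandomPlanarGeometry.SAW.Zd

end
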